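/-
Copyright (c) 2026 the pub-hodgecm-mathlib formalisation cell (harness21).  Prover seat hodgecm-mathlib-K2Liu-p09 (g6): Track B «K2-LIT»,
hLiu418 = stmt-HodgeConjecture-24832; LEAD F0P6-plan RULING M-158d «A7-val road (σ)», instance layer I-4a (the section map `𝒜 : Φ ↦ f^Δ_Φ` of the (A4″-KR) instance).
-/
import Summits.HodgeConjecture.HodgeConjecture.Theorems.K2LiuA7ValueInstanceSiegelLaw      -- ★ I-3c p860736 (`swSectionDelta_transport_mem_localDegPS`; brings (S4-law), (β-3∕mover), β-1)
import Summits.HodgeConjecture.HodgeConjecture.Theorems.K2LiuA7ValueInstancePartnerLaws    -- ★ I-3b p860708 (`swSectionDelta_leviEquivSB_rhoLoc`, `continuous_rhoLoc`; brings ★ I-2 `rhoLoc`)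
import HarnessLib

/-!
# Crux `HLiu418`, road `K2_Liu`, organ A7-val, instance layer I-4a: THE SECTION MAP `𝒜 : 𝒮(X_Δ) →ₗ I_v(s₀, (χ^{M₂})_v)`, `Φ ↦ f^Δ_Φ|_{H_v}`

Cell `hodgecm-mathlib`, crux item hLiu418 = `stmt-HodgeConjecture-24832`; squad K2 ∕ K2Liu; prover K2Liu-p09 (g6), organ lead A7-val.  DEFINITION LANE
(`--supports stmt-HodgeConjecture-24832 --as helper`): ONE definition with body + its API; no instance, no notation, no sorry.  Setting of ★ I-3c (the WEIL DATUM
OF RECORD `s_𝔻 := (finSplittings …).s v`, a normalised Δ-intertwiner `Γ`, `s^Δ_B := mpTransportLoc Γ ∘ s_𝔻 ∘ tensorEmbLoc`).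
* **`sectionMapLoc … s₀ hs₀ : 𝒮(L⁺_v^{n′+n′}) →ₗ[ℂ] ↥(localDegPS … (χ^{M₂})_v s₀)`**, `Ψ ↦ f^Δ_Ψ|_{H_v}` (`s₀ = (M₂ − n)∕2`; ★ I-3c membership, ★ β-1 linearity) — THE `𝒜` OF
  ★ V8e `K2LiuA7ValueFaceTwo.face_two_of_laws` at the instance (`n = 2`, `M₂ = 3`, `s₀ = ½`);
* `coe_sectionMapLoc` (its values), **`sectionMapLoc_toRep`** — THE BINDER `h𝒜`: `𝒜 (ω^Δ(s^Δ_B u) Φ) (x) = 𝒜 Φ (x u)` (★ β-1 `swSectionDelta_mul_right`);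
  **`sectionMapLoc_leviEquivSB_rhoLoc`** — THE BINDER `h𝒜G` in `𝒜`-form (★ I-3b `swSectionDelta_leviEquivSB_rhoLoc`, `hsproj` = the record splitting's `proj_s`).
HONEST LABEL.  `HC_CM` is proved only modulo the 7 printed citations (2 remaining named inputs: hLiu418 = `stmt-HodgeConjecture-24832`,
h413 = `stmt-HodgeConjecture-24833`) until rung 0 closes.

## References
* [KudlaRallis1994] S. Kudla, S. Rallis, Ann. of Math. 140 (1994), §1 (the `H`-equivariant map `Φ ↦ f_Φ : 𝒮 → I(s₀, χ)`).
* [GanQiuTakeda2014] W. T. Gan, Y. Qiu, S. Takeda, Invent. Math. 198 (2014), §5.4.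
* [MoeglinVignerasWaldspurger1987] C. Mœglin, M.-F. Vignéras, J.-L. Waldspurger, LNM 1291, Chap. 1 I.17, Chap. 2 II.6.
-/

set_option autoImplicit false
set_option linter.dupNamespace false -- the mandated namespace repeats `HodgeConjecture.HodgeConjecture`

noncomputable section

open scoped Matrix TensorProduct Classical
open NumberField IsDedekindDomain Filter MeasureTheory
open Literature.RepresentationTheory.HeisenbergGroup
open Literature.NumberTheory.Automorphic Literature.NumberTheory.Automorphic.UnitaryGroup Literature.NumberTheory.GaloisRepresentations
open Literature.NumberTheory.Weil1964 Literature.RepresentationTheory.HarrisKudlaSweet1996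
open Literature.NumberTheory.GelbartRogawski1991 Literature.NumberTheory.GelbartRogawski1991.GRConstruction
open Literature.NumberTheory.GelbartRogawski1991.UnitaryDualPair
open Literature.NumberTheory.GelbartRogawski1991.UnitaryDualPair.LocalSplitting
open Literature.NumberTheory.K2Lit.SiegelDoubled Literature.NumberTheory.K2Lit.LocalSiegelDoubled
open Summit.HodgeConjecture.HodgeConjecture.Cruxes.HLiu418.K2LiuDoublingSchrodingerModelDefs
open Summit.HodgeConjecture.HodgeConjecture.Cruxes.HLiu418.K2LiuDoublingModelComparison
open Summit.HodgeConjecture.HodgeConjecture.Cruxes.HLiu418.K2LiuLocalSWSectionDefs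
open Summit.HodgeConjecture.HodgeConjecture.Cruxes.HLiu418.K2LiuSWSectionPlaceFactorisation
open Summit.HodgeConjecture.HodgeConjecture.Cruxes.HLiu418.K2LiuSWSectionTensorPlaceFactorisation
open Summit.HodgeConjecture.HodgeConjecture.Cruxes.HLiu418.K2LiuA7ValueInstanceDefs
open Summit.HodgeConjecture.HodgeConjecture.Cruxes.HLiu418.K2LiuA7ValueInstancePartnerLaws
open Summit.HodgeConjecture.HodgeConjecture.Cruxes.HLiu418.K2LiuA7ValueInstanceSiegelLaw

namespace Summit.HodgeConjecture.HodgeConjecture.Cruxes.HLiu418.K2LiuA7ValueInstanceSectionMap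

variable (L : Type) [Field L] [NumberField L] [IsCMField L] [Algebra.IsQuadraticExtension (Fp L) L]
variable {N M n : ℕ} (e : Fin N × Fin M ≃ Fin n)
  (dV : Fin N → L) (hdV : ∀ i, IsCMField.complexConj L (dV i) = dV i) (hdV0 : ∀ i, dV i ≠ 0)
  (dW : Fin M → L) (hdW : ∀ i, IsCMField.complexConj L (dW i) = dW i) (hdW0 : ∀ i, dW i ≠ 0)
variable {M₂ M' n' : ℕ} (eW : Fin M × Fin M₂ ≃ Fin M') (e' : Fin N × Fin M' ≃ Fin n')
  (dV' : Fin M₂ → L) (hdV' : ∀ k, IsCMField.complexConj L (dV' k) = dV' k) (hdV'0 : ∀ k, dV' k ≠ 0) (hM₂ : M₂ ≠ 0)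
variable (χ : HeckeCharacter L) (𝔪 : ∀ v, PlaceMeasure L v)
  (𝓕 : FinLocalFamily L e' dV hdV hdV0 (tensorFrame L dW eW dV') (tensorFrame_real L dW hdW eW dV' hdV') (tensorFrame_ne_zero L dW eW dV' hdW0 hdV'0) χ 𝔪)
  (v : HeightOneSpectrum (𝓞 (Fp L)))
  [MeasurableSpace (Fin n' → v.adicCompletion (Fp L))] [BorelSpace (Fin n' → v.adicCompletion (Fp L))]
  (μ : Measure (Fin n' → v.adicCompletion (Fp L))) [μ.IsAddHaarMeasure]
  (Γ : SchwartzBruhat (Fin (n' + n') → v.adicCompletion (Fp L)) ≃ₗ[ℂ] SchwartzBruhat (Fin (n' + n') → v.adicCompletion (Fp L)))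
  (hΓ : IsDeltaIntertwiner L e' dV hdV (tensorFrame L dW eW dV') (tensorFrame_real L dW hdW eW dV' hdV') v Γ)
  (hΓ0 : ∀ Ψ : SchwartzBruhat (Fin (n' + n') → v.adicCompletion (Fp L)),
    ((Γ Ψ : SchwartzBruhat (Fin (n' + n') → v.adicCompletion (Fp L))) : (Fin (n' + n') → v.adicCompletion (Fp L)) → ℂ) 0 =
      diagIntegral (GRConstruction.e₂ (n := n')) μ Ψ)
  (s₀ : ℂ) (hs₀ : s₀ = ((M₂ : ℂ) - (n : ℂ)) / 2)

set_option maxHeartbeats 800000 in -- as ★ I-3c (the record pair `m₀,v` behind the membership proof)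
/-- **`𝒜 = sectionMapLoc : 𝒮(L⁺_v^{n′+n′}) →ₗ[ℂ] I_v(s₀, (χ^{M₂})_v)`, `Ψ ↦ f^Δ_Ψ|_{H_v}`** — the Siegel–Weil section of `Ψ` in the Δ-model along the face's splitting
`s^Δ_B = mpTransportLoc Γ ∘ s_𝔻 ∘ tensorEmbLoc`, as an element of the K2Lit degenerate principal series at `s₀ = (M₂ − n)∕2` (★ I-3c `swSectionDelta_transport_mem_localDegPS`;
linear by ★ β-1 `swSectionDelta_add ∕ _smul`).  The `𝒜` of ★ V8e `face_two_of_laws` (`n = 2`, `M₂ = 3`, `s₀ = ½`). [cite: KudlaRallis1994, §1] [cite: GanQiuTakeda2014, §5.4] -/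
def sectionMapLoc :
    SchwartzBruhat (Fin (n' + n') → v.adicCompletion (Fp L)) →ₗ[ℂ]
      ↥(localDegPS (Fp L) L (IsCMField.complexConj L) (complexConj_imagUnit L) (imagUnit_ne_zero L) (imagUnit_mul_self L)
          v n (gramR_isSymm L e dV hdV dW hdW) (hermD_eq_map_gramD L e dV hdV dW hdW) (fun w => (χ ^ M₂).localComponent w.1) s₀) where
  toFun Ψ := ⟨swSectionDelta L e' dV hdV (tensorFrame L dW eW dV') (tensorFrame_real L dW hdW eW dV' hdV') v
      ((mpTransportLoc L e' dV hdV (tensorFrame L dW eW dV') (tensorFrame_real L dW hdW eW dV' hdV') v Γ hΓ).toMonoidHom.comp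
        (((finSplittings L e' dV hdV hdV0 (tensorFrame L dW eW dV') (tensorFrame_real L dW hdW eW dV' hdV') (tensorFrame_ne_zero L dW eW dV' hdW0 hdV'0) χ 𝔪 𝓕).s v).comp
          (tensorEmbLoc L e dV hdV dW hdW eW e' dV' hdV' v))) Ψ,
    hs₀ ▸ swSectionDelta_transport_mem_localDegPS L e dV hdV hdV0 dW hdW hdW0 eW e' dV' hdV' hdV'0 χ 𝔪 𝓕 v μ Γ hΓ hΓ0 hM₂ Ψ⟩
  map_add' Ψ Ψ' := Subtype.ext (funext fun h => swSectionDelta_add L e' dV hdV (tensorFrame L dW eW dV') (tensorFrame_real L dW hdW eW dV' hdV') v _ Ψ Ψ' h)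
  map_smul' a Ψ := Subtype.ext (funext fun h => swSectionDelta_smul L e' dV hdV (tensorFrame L dW eW dV') (tensorFrame_real L dW hdW eW dV' hdV') v _ a Ψ h)

/-- the values of `𝒜 Ψ`: `f^Δ_Ψ(h)` along `s^Δ_B`. [cite: KudlaRallis1994, §1] -/
theorem coe_sectionMapLoc (Ψ : SchwartzBruhat (Fin (n' + n') → v.adicCompletion (Fp L))) :
    ((sectionMapLoc L e dV hdV hdV0 dW hdW hdW0 eW e' dV' hdV' hdV'0 hM₂ χ 𝔪 𝓕 v μ Γ hΓ hΓ0 s₀ hs₀ Ψ :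
        ↥(localDegPS (Fp L) L (IsCMField.complexConj L) (complexConj_imagUnit L) (imagUnit_ne_zero L) (imagUnit_mul_self L)
          v n (gramR_isSymm L e dV hdV dW hdW) (hermD_eq_map_gramD L e dV hdV dW hdW) (fun w => (χ ^ M₂).localComponent w.1) s₀)) :
        UnitaryGroup.localPi L (IsCMField.complexConj L) (n + n) (hermD L e dV hdV dW hdW) v → ℂ) =
      swSectionDelta L e' dV hdV (tensorFrame L dW eW dV') (tensorFrame_real L dW hdW eW dV' hdV') v
        ((mpTransportLoc L e' dV hdV (tensorFrame L dW eW dV') (tensorFrame_real L dW hdW eW dV' hdV') v Γ hΓ).toMonoidHom.comp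
          (((finSplittings L e' dV hdV hdV0 (tensorFrame L dW eW dV') (tensorFrame_real L dW hdW eW dV' hdV') (tensorFrame_ne_zero L dW eW dV' hdW0 hdV'0) χ 𝔪 𝓕).s v).comp
            (tensorEmbLoc L e dV hdV dW hdW eW e' dV' hdV' v))) Ψ :=
  rfl

set_option maxHeartbeats 800000 in -- as ★ I-3c
/-- **`h𝒜` AT THE INSTANCE: `𝒜 (ω^Δ(s^Δ_B u) Φ) (x) = 𝒜 Φ (x u)`** — `Φ ↦ f^Δ_Φ` is `H_v`-equivariant for right translation (★ β-1 `swSectionDelta_mul_right`).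
[cite: KudlaRallis1994, §1] -/
theorem sectionMapLoc_toRep (u : UnitaryGroup.localPi L (IsCMField.complexConj L) (n + n) (hermD L e dV hdV dW hdW) v)
    (Φ : SchwartzBruhat (Fin (n' + n') → v.adicCompletion (Fp L))) (x : UnitaryGroup.localPi L (IsCMField.complexConj L) (n + n) (hermD L e dV hdV dW hdW) v) :
    ((sectionMapLoc L e dV hdV hdV0 dW hdW hdW0 eW e' dV' hdV' hdV'0 hM₂ χ 𝔪 𝓕 v μ Γ hΓ hΓ0 s₀ hs₀
          (MpPsi.toRep (localSchrodingerDelta L e' dV hdV (tensorFrame L dW eW dV') (tensorFrame_real L dW hdW eW dV' hdV') v)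
            (((mpTransportLoc L e' dV hdV (tensorFrame L dW eW dV') (tensorFrame_real L dW hdW eW dV' hdV') v Γ hΓ).toMonoidHom.comp
              (((finSplittings L e' dV hdV hdV0 (tensorFrame L dW eW dV') (tensorFrame_real L dW hdW eW dV' hdV') (tensorFrame_ne_zero L dW eW dV' hdW0 hdV'0) χ 𝔪 𝓕).s v).comp
                (tensorEmbLoc L e dV hdV dW hdW eW e' dV' hdV' v))) u) Φ) :
        ↥(localDegPS (Fp L) L (IsCMField.complexConj L) (complexConj_imagUnit L) (imagUnit_ne_zero L) (imagUnit_mul_self L)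
          v n (gramR_isSymm L e dV hdV dW hdW) (hermD_eq_map_gramD L e dV hdV dW hdW) (fun w => (χ ^ M₂).localComponent w.1) s₀)) :
        UnitaryGroup.localPi L (IsCMField.complexConj L) (n + n) (hermD L e dV hdV dW hdW) v → ℂ) x =
      ((sectionMapLoc L e dV hdV hdV0 dW hdW hdW0 eW e' dV' hdV' hdV'0 hM₂ χ 𝔪 𝓕 v μ Γ hΓ hΓ0 s₀ hs₀ Φ :
        ↥(localDegPS (Fp L) L (IsCMField.complexConj L) (complexConj_imagUnit L) (imagUnit_ne_zero L) (imagUnit_mul_self L)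
          v n (gramR_isSymm L e dV hdV dW hdW) (hermD_eq_map_gramD L e dV hdV dW hdW) (fun w => (χ ^ M₂).localComponent w.1) s₀)) :
        UnitaryGroup.localPi L (IsCMField.complexConj L) (n + n) (hermD L e dV hdV dW hdW) v → ℂ) (x * u) := by
  rw [coe_sectionMapLoc, coe_sectionMapLoc]
  exact (swSectionDelta_mul_right L e' dV hdV (tensorFrame L dW eW dV') (tensorFrame_real L dW hdW eW dV' hdV') v _ Φ x u).symm

set_option maxHeartbeats 800000 in -- as ★ I-3b∕I-3c
/-- **`h𝒜G` AT THE INSTANCE, `𝒜`-form: `𝒜 (L(ρ g) Φ) = 𝒜 Φ` pointwise** (★ I-3b `swSectionDelta_leviEquivSB_rhoLoc`; the record splitting lies over `ι`, ★ `FinLocalSplittings.proj_s`).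
[cite: KudlaRallis1994, §1] [cite: MoeglinVignerasWaldspurger1987, Chap. 1 I.17] -/
theorem sectionMapLoc_leviEquivSB_rhoLoc (g : UnitaryGroup.localPi L (IsCMField.complexConj L) M₂ (Matrix.diagonal dV') v)
    (Φ : SchwartzBruhat (Fin (n' + n') → v.adicCompletion (Fp L))) (x : UnitaryGroup.localPi L (IsCMField.complexConj L) (n + n) (hermD L e dV hdV dW hdW) v) :
    ((sectionMapLoc L e dV hdV hdV0 dW hdW hdW0 eW e' dV' hdV' hdV'0 hM₂ χ 𝔪 𝓕 v μ Γ hΓ hΓ0 s₀ hs₀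
          (leviEquivSB (rhoLoc L (complexConj_imagUnit L) (imagUnit_ne_zero L) e dV hdV dW hdW eW e' dV' hdV' v g)
            (continuous_rhoLoc L e dV hdV dW hdW eW e' dV' hdV' v g).1 (continuous_rhoLoc L e dV hdV dW hdW eW e' dV' hdV' v g).2 Φ) :
        ↥(localDegPS (Fp L) L (IsCMField.complexConj L) (complexConj_imagUnit L) (imagUnit_ne_zero L) (imagUnit_mul_self L)
          v n (gramR_isSymm L e dV hdV dW hdW) (hermD_eq_map_gramD L e dV hdV dW hdW) (fun w => (χ ^ M₂).localComponent w.1) s₀)) :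
        UnitaryGroup.localPi L (IsCMField.complexConj L) (n + n) (hermD L e dV hdV dW hdW) v → ℂ) x =
      ((sectionMapLoc L e dV hdV hdV0 dW hdW hdW0 eW e' dV' hdV' hdV'0 hM₂ χ 𝔪 𝓕 v μ Γ hΓ hΓ0 s₀ hs₀ Φ :
        ↥(localDegPS (Fp L) L (IsCMField.complexConj L) (complexConj_imagUnit L) (imagUnit_ne_zero L) (imagUnit_mul_self L)
          v n (gramR_isSymm L e dV hdV dW hdW) (hermD_eq_map_gramD L e dV hdV dW hdW) (fun w => (χ ^ M₂).localComponent w.1) s₀)) :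
        UnitaryGroup.localPi L (IsCMField.complexConj L) (n + n) (hermD L e dV hdV dW hdW) v → ℂ) x := by
  rw [coe_sectionMapLoc, coe_sectionMapLoc]
  exact swSectionDelta_leviEquivSB_rhoLoc L e dV hdV hdV0 dW hdW hdW0 eW e' dV' hdV' hdV'0 v Γ hΓ _
    (fun g' => (finSplittings L e' dV hdV hdV0 (tensorFrame L dW eW dV') (tensorFrame_real L dW hdW eW dV' hdV')
      (tensorFrame_ne_zero L dW eW dV' hdW0 hdV'0) χ 𝔪 𝓕).proj_s v g') g Φ x

end Summit.HodgeConjecture.HodgeConjecture.Cruxes.HLiu418.K2LiuA7ValueInstanceSectionMap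

end
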